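import Mathlib
import Summits.Ventures.PercRepro.TriangleCapDenseEquality

/-!
# PercRepro — lemmas for the stability of Mantel's degree-sum lemma (p3, gen 34; part 30a)

Bookkeeping for TriangleCapMantelStability: the deficit of an ordered pair is symmetric (`deficit_swap`) and the
swap carries the deficit sum over a class of ordered adjacent pairs to its mirror class
(`sum_deficit_filter_swap`); four pairwise exclusive classes of a sum of naturals are bounded by the whole
sum (`sum_four_filters_le`); sums over the pairs `(x, y₀)` / `(x₀, y)` (`sum_image_pair_left` /
`sum_image_pair_right`); and `a·b ≥ a + b − 1` for `a, b ≥ 1` (`mul_ge_add_sub_one`).  Axioms: standard.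
-/

namespace PercRepro

namespace TriangleCap

namespace C047

open Finset

variable {V : Type*} [Fintype V] [DecidableEq V]

omit [DecidableEq V] in
/-- The deficit is symmetric. -/
theorem deficit_swap (D : SimpleGraph V) [DecidableRel D.Adj] (a b : V) :
    deficit D (a, b) = deficit D (b, a) := by
  unfold deficit
  congr 1
  ext x
  simp only [mem_filter, mem_univ, true_and]
  exact and_comm

omit [DecidableEq V] in
/-- The swap `(a, b) ↦ (b, a)` carries the deficit sum over one class of pairs to its mirror class. -/
theorem sum_deficit_filter_swap (D : SimpleGraph V) [DecidableRel D.Adj] (P Q : V × V → Prop)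
    [DecidablePred P] [DecidablePred Q] (h : ∀ p, P p ↔ Q p.swap) :
    ∑ p ∈ (adjPairsAll D).filter P, deficit D p = ∑ p ∈ (adjPairsAll D).filter Q, deficit D p := by
  apply sum_nbij' Prod.swap Prod.swap
  · intro p hp
    simp only [mem_filter, mem_adjPairsAll, Prod.fst_swap, Prod.snd_swap] at hp ⊢
    exact ⟨hp.1.symm, (h p).mp hp.2⟩
  · intro p hp
    simp only [mem_filter, mem_adjPairsAll, Prod.fst_swap, Prod.snd_swap] at hp ⊢
    refine ⟨hp.1.symm, ?_⟩
    rw [h, Prod.swap_swap]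
    exact hp.2
  · intro p _
    exact Prod.swap_swap p
  · intro p _
    exact Prod.swap_swap p
  · intro p _
    exact deficit_swap D p.1 p.2

/-- Four pairwise exclusive classes of a sum of naturals are bounded by the whole sum. -/
theorem sum_four_filters_le {ι : Type*} [DecidableEq ι] (s : Finset ι) (f : ι → ℕ) (P₁ P₂ P₃ P₄ : ι → Prop)
    [DecidablePred P₁] [DecidablePred P₂] [DecidablePred P₃] [DecidablePred P₄]
    (h21 : ∀ a, P₂ a → ¬ P₁ a) (h31 : ∀ a, P₃ a → ¬ P₁ a) (h32 : ∀ a, P₃ a → ¬ P₂ a)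
    (h41 : ∀ a, P₄ a → ¬ P₁ a) (h42 : ∀ a, P₄ a → ¬ P₂ a) (h43 : ∀ a, P₄ a → ¬ P₃ a) :
    ∑ a ∈ s.filter P₁, f a + ∑ a ∈ s.filter P₂, f a + ∑ a ∈ s.filter P₃, f a +
      ∑ a ∈ s.filter P₄, f a ≤ ∑ a ∈ s, f a := by
  have d12 : Disjoint (s.filter P₁) (s.filter P₂) := by
    rw [disjoint_filter]
    exact fun a _ h1 h2 => h21 a h2 h1
  have d123 : Disjoint (s.filter P₁ ∪ s.filter P₂) (s.filter P₃) := by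
    rw [disjoint_union_left, disjoint_filter, disjoint_filter]
    exact ⟨fun a _ h1 h3 => h31 a h3 h1, fun a _ h2 h3 => h32 a h3 h2⟩
  have d1234 : Disjoint (s.filter P₁ ∪ s.filter P₂ ∪ s.filter P₃) (s.filter P₄) := by
    rw [disjoint_union_left, disjoint_union_left, disjoint_filter, disjoint_filter, disjoint_filter]
    exact ⟨⟨fun a _ h1 h4 => h41 a h4 h1, fun a _ h2 h4 => h42 a h4 h2⟩, fun a _ h3 h4 => h43 a h4 h3⟩
  rw [← sum_union d12, ← sum_union d123, ← sum_union d1234]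
  apply sum_le_sum_of_subset
  intro a ha
  simp only [mem_union, mem_filter] at ha
  rcases ha with ((h | h) | h) | h <;> exact h.1

omit [Fintype V] in
/-- A sum over the pairs `(x, y₀)`, `x ∈ s`. -/
theorem sum_image_pair_left (s : Finset V) (y₀ : V) (f : V × V → ℕ) :
    ∑ p ∈ s.image (fun x => (x, y₀)), f p = ∑ x ∈ s, f (x, y₀) := by
  rw [sum_image]
  intro a _ b _ h
  exact (Prod.mk.inj h).1

omit [Fintype V] in
/-- A sum over the pairs `(x₀, y)`, `y ∈ s`. -/
theorem sum_image_pair_right (s : Finset V) (x₀ : V) (f : V × V → ℕ) :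
    ∑ p ∈ s.image (fun y => (x₀, y)), f p = ∑ y ∈ s, f (x₀, y) := by
  rw [sum_image]
  intro a _ b _ h
  exact (Prod.mk.inj h).2

/-- `a·b ≥ a + b − 1` for `a, b ≥ 1`. -/
theorem mul_ge_add_sub_one (a b : ℕ) (ha : 1 ≤ a) (hb : 1 ≤ b) : a + b ≤ a * b + 1 := by
  nlinarith

end C047

end TriangleCap

end PercRepro
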